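import Summits.BirchSwinnertonDyer.Rank1Residual.X2.TwistParityStability
import HarnessLib

/-!
# The Greenberg–Vatsal type at an odd MULTIPLICATIVE prime: type A certified by a rational `p`-torsion
# point on an EVEN quadratic twist (cell `bsd-eis`, seat `bsd-eis-k5-c3` g2; THEOREMS ONLY)

HONEST FRAMING (FULL-BSD rank-≤1 programme D-0033, cell `bsd-eis`, home `run/shared/lean/pub/bsd-eis/`; row
A10 = sub-cell X2b, `¬GVPar`). Nothing booked, no label moves. The multiplicative twin of x1a's
`Rank1Residual.not_gvPar_of_twist_pos_of_nsmul_eq_zero` (good ordinary `p`,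
`GVParityTwistTransportProofs.lean`): at an odd MULTIPLICATIVE prime `p` of a globally minimal `W` (granted the
two Tate-uniformisation facts `hT`, `hT'` of `X2/TwistParityStability.lean`), a rational point of order `p` on a
model `Wd` of the EVEN twist `E^{(d)}` (`d > 0`, `p ∤ d`) certifies `¬ GVPar W p`: along the sign-equivariant
identification `E^{(d)}[p] ≃ E[p]` (`exists_signEquiv_of_twist`; inertia above `p` and complex conjugation fix
`√d`) the line `ℤP` becomes a rational line of `E[p]` which is unramified at `p` and even, i.e. of co-type, and
one co-type line forces type A at an odd multiplicative prime (`X2.not_gvPar_of_isRationalLine_of_mult`). This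
is the kernel certificate for the A10 cells whose unramified constituent is a non-trivial even character (no
rational `3`-torsion anywhere in the class; at `p = 3` a real quadratic `χ_d`: e.g. `294576df1`, `d = 19`).
References: [GreenbergVatsal2000] Thm. (1.3) and the remark after it (even twists prime to `p` preserve the
hypotheses), §2 p. 28; [SilvermanAEC2009] X.5 Cor. 5.4; [SilvermanATAEC1994] Thm. V.5.3, Cor. V.5.4.
-/

set_option autoImplicit false

noncomputable section

open scoped Classical

open WeierstrassCurve Literature.NumberTheory.EllipticCurves Literature.NumberTheory.GaloisRepresentations
  Field IsDedekindDomain NumberField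
  Literature.NumberTheory.EllipticCurves.Rank1Residual

namespace Summit.BirchSwinnertonDyer.Rank1Residual.X2

variable {W Wd : WeierstrassCurve ℚ} {p : ℕ} [hp : Fact p.Prime] [W.IsElliptic] [W.IsGloballyMinimal]

variable (W) in
/-- **A rational point of order `p` on an EVEN twist certifies type A at an odd multiplicative prime**
(globally minimal `W`, granted `hT`, `hT'`): for `d > 0` with `p ∤ d`, a model `Wd` of `E^{(d)}`
(`C • Wd = W.quadraticTwist d`) and `P ∈ E^{(d)}(ℚ)`, `P ≠ O`, `p • P = O`: `¬ GVPar W p` — the image of `ℤP`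
under the sign-equivariant `E^{(d)}[p] ≃ E[p]` is a rational line of `E[p]`, unramified at `p` (inertia fixes
`√d` as `p ∤ 4d`) and even (complex conjugation fixes `√d` as `d > 0`), hence of co-type
(`not_gvPar_of_isRationalLine_of_mult`). The multiplicative twin of
`Rank1Residual.not_gvPar_of_twist_pos_of_nsmul_eq_zero`.
[cite: GreenbergVatsal2000, Thm. (1.3) and the remark after it, §2 p. 28] [cite: SilvermanAEC2009, X.5 Cor. 5.4] -/
theorem not_gvPar_of_twist_pos_of_nsmul_eq_zero_of_mult
    (hT : Silverman1994_thmV53_tateUniformisation.{0})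
    (hT' : Silverman1994_thmV53_corV54_tateUniformisation.{0})
    (hp2 : p ≠ 2) (hmult : W.HasMultiplicativeReductionAtPrime p)
    {d : ℤ} (hd : 0 < d) (hpd : ¬ (p : ℤ) ∣ d)
    (C : VariableChange ℚ) (hC : C • Wd = W.quadraticTwist ((d : ℤ) : ℚ))
    (P : Wd.toAffine.Point) (hP0 : P ≠ 0) (hpP : p • P = 0) : ¬ GVPar W p := by
  have hd0 : ((d : ℤ) : ℚ) ≠ 0 := by exact_mod_cast hd.ne'
  have hdpos : (0 : ℚ) < ((d : ℤ) : ℚ) := by exact_mod_cast hd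
  obtain ⟨e, hpos, hneg⟩ := exists_signEquiv_of_twist (W := W) (Wd := Wd) (p := p) hd0 C hC
  obtain ⟨Ψ, hΨ, -, hu, he⟩ := exists_isRationalLine_of_nsmul_eq_zero Wd P hP0 hpP
  have hI : ∀ (v : HeightOneSpectrum (𝓞 ℚ)), (p : 𝓞 ℚ) ∈ v.asIdeal → ∀ 𝔓 ∈ v.primesAbove,
      ∀ σ ∈ 𝔓.inertia (absoluteGaloisGroup ℚ), σ • geomSqrt ((d : ℤ) : ℚ) = geomSqrt ((d : ℤ) : ℚ) :=
    fun v hv 𝔓 h𝔓 σ hσ ↦ smul_geomSqrt_eq_of_mem_inertia (p := p) (not_dvd_four_mul hp2 hpd) hv h𝔓 hσ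
  have hcc : ∀ c : absoluteGaloisGroup ℚ, IsComplexConjugation (Rat.castHom ℝ) c →
      c • geomSqrt ((d : ℤ) : ℚ) = geomSqrt ((d : ℤ) : ℚ) :=
    fun c hc ↦ smul_geomSqrt_eq_of_isComplexConjugation_of_pos hdpos hc
  have hΦ : IsRationalLine W p (Ψ.map e.toAddMonoidHom) := isRationalLine_map_signEquiv e _ hpos hneg hΨ
  have hu' : LineUnramifiedAt W p (Ψ.map e.toAddMonoidHom) :=
    (lineUnramifiedAt_map_signEquiv_iff e _ hpos hI Ψ).mpr hu
  have he' : LineEven W p (Ψ.map e.toAddMonoidHom) :=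
    (lineEven_map_signEquiv_iff_of_pos e _ hpos hcc Ψ).mpr he
  refine not_gvPar_of_isRationalLine_of_mult hT hT' hp2 hmult hΦ ?_
  rintro (⟨hr, -⟩ | ⟨-, ho⟩)
  · exact hr hu'
  · exact lineEven_lineOdd_false hp2 hΦ he' ho

end Summit.BirchSwinnertonDyer.Rank1Residual.X2

end
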